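import Mathlib
import Literature.MathematicalPhysics.QuantumLattice.RandomField
import HarnessLib

/-!
# Crux `GaussianLimitIsFree` (item stmt-CriticalPhenomena-2601), line `registered` (birth v8):
# identification of the a.e. limit of a reverse martingale (stub `stub_reverseMartingale_limit_eq_condExp`)

THEOREM-ONLY helper file for the sorry-free glue `stub_markovInheritance` of the skeleton
`Cruxes/GaussianLimitIsFree/Lines/birth.lean` (v8), which passes Rozanov's collar Markov identity to
germ σ-algebras along `εₙ = 1/(n+1)` by Lévy's downward theorem.  The downward theorem is split in
two: a neighbour stub produces an a.e. limit `G` of the reverse martingale `μ[F | ℱ n]` for a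
sequence of sub-σ-algebras `ℱ n`; the present file identifies ANY such bounded, `(⨅ n, ℱ n)`-measurable
a.e. limit with the conditional expectation on the intersection: `G = μ[F | ⨅ n, ℱ n]` a.e.

Proof (pure measure theory on a finite measure space, `ae_eq_condExp_iInf_of_tendsto_condExp`):
by uniqueness of the conditional expectation (`ae_eq_condExp_of_forall_setIntegral_eq`) it suffices
to check `∫_A G = ∫_A F` for every `A ∈ ⨅ n, ℱ n`.  Such an `A` lies in every `ℱ n`, so
`∫_A μ[F | ℱ n] = ∫_A F` for all `n` (`setIntegral_condExp`), while `∫_A μ[F | ℱ n] → ∫_A G` by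
dominated convergence with the constant bound `C` (`|μ[F | ℱ n]| ≤ C` a.e.,
`ae_bdd_abs_condExp_of_ae_bdd_abs`); the limit of a constant sequence is that constant.
Antitonicity of `ℱ` is part of the registered signature but is not used.

References: standard (e.g. D. Williams, *Probability with Martingales*, §14.4; Yu. A. Rozanov,
*Markov Random Fields*, Springer 1982, Ch. 1 §1.4 for the use with germ σ-algebras).
-/

noncomputable section

namespace Summit.CriticalPhenomena.Ising3DConformalLimit.Cruxes.GaussianLimitIsFree.Birth

open MeasureTheory Filter
open scoped Topology

section General

variable {Ω : Type*} {mΩ : MeasurableSpace Ω}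

/-- A bounded measurable real function on a finite measure space is integrable. [folklore] -/
theorem integrable_of_abs_le_const (μ : Measure Ω) [IsFiniteMeasure μ] {F : Ω → ℝ}
    (hF : Measurable F) {C : ℝ} (hC : ∀ ω, |F ω| ≤ C) : Integrable F μ :=
  (integrable_const C).mono' hF.aestronglyMeasurable (ae_of_all _ fun ω => by
    rw [Real.norm_eq_abs]; exact hC ω)

/-- **Identification of reverse-martingale limits.**  On a finite measure space, let `ℱ n` be
sub-σ-algebras of the ambient one, `F` bounded measurable, and `G` bounded and measurable for
`⨅ n, ℱ n`.  If `μ[F | ℱ n] → G` a.e., then `G = μ[F | ⨅ n, ℱ n]` a.e. (uniqueness of the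
conditional expectation + dominated convergence; no monotonicity of `ℱ` is needed). [folklore] -/
theorem ae_eq_condExp_iInf_of_tendsto_condExp (μ : Measure Ω) [IsFiniteMeasure μ]
    (ℱ : ℕ → MeasurableSpace Ω) (hle : ∀ n, ℱ n ≤ mΩ) {F G : Ω → ℝ} {C : ℝ}
    (hFm : Measurable F) (hFb : ∀ ω, |F ω| ≤ C) (hGm : Measurable[⨅ n, ℱ n] G)
    (hGb : ∀ ω, |G ω| ≤ C)
    (hlim : ∀ᵐ ω ∂μ, Tendsto (fun n => (μ[F | ℱ n]) ω) atTop (𝓝 (G ω))) :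
    G =ᵐ[μ] μ[F | ⨅ n, ℱ n] := by
  have hm : (⨅ n, ℱ n) ≤ mΩ := (iInf_le ℱ 0).trans (hle 0)
  have hFi : Integrable F μ := integrable_of_abs_le_const μ hFm hFb
  have hGi : Integrable G μ := integrable_of_abs_le_const μ (hGm.mono hm le_rfl) hGb
  refine ae_eq_condExp_of_forall_setIntegral_eq hm hFi (fun s _ _ => hGi.integrableOn) ?_
    hGm.stronglyMeasurable.aestronglyMeasurable
  intro s hs _
  have hsn : ∀ n, MeasurableSet[ℱ n] s := MeasurableSpace.measurableSet_iInf.1 hs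
  -- `∫_s μ[F | ℱ n] → ∫_s G` by dominated convergence with the constant bound `C`
  have hG : Tendsto (fun n => ∫ x in s, (μ[F | ℱ n]) x ∂μ) atTop (𝓝 (∫ x in s, G x ∂μ)) := by
    refine tendsto_integral_of_dominated_convergence (fun _ => C)
      (fun n => (stronglyMeasurable_condExp.mono (hle n)).aestronglyMeasurable)
      (integrable_const C) (fun n => ae_restrict_of_ae ?_) (ae_restrict_of_ae hlim)
    filter_upwards [ae_bdd_abs_condExp_of_ae_bdd_abs (μ := μ) (m := ℱ n)
      (Eventually.of_forall hFb)] with x hx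
    rw [Real.norm_eq_abs]
    exact hx
  -- while `∫_s μ[F | ℱ n] = ∫_s F` for every `n`
  have hF : Tendsto (fun n => ∫ x in s, (μ[F | ℱ n]) x ∂μ) atTop (𝓝 (∫ x in s, F x ∂μ)) := by
    have h : (fun n => ∫ x in s, (μ[F | ℱ n]) x ∂μ) = fun _ => ∫ x in s, F x ∂μ :=
      funext fun n => setIntegral_condExp (hle n) hFi (hsn n)
    rw [h]
    exact tendsto_const_nhds
  exact tendsto_nhds_unique hG hF

end General

/-- **Stub `stub_reverseMartingale_limit_eq_condExp`** (registered signature): on the space of field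
configurations `𝒮'(ℝ³)` with a probability law `μ`, for sub-σ-algebras `ℱ n` of the Borel
σ-algebra, a bounded measurable `F` and a bounded `(⨅ n, ℱ n)`-measurable `G`, if `μ[F | ℱ n] → G`
a.e. then `G = μ[F | ⨅ n, ℱ n]` a.e.  Specialisation of
`ae_eq_condExp_iInf_of_tendsto_condExp`. [folklore] -/
theorem stub_reverseMartingale_limit_eq_condExp :
    ∀ (μ : MeasureTheory.Measure (Literature.MathematicalPhysics.QuantumLattice.FieldConfig (EuclideanSpace ℝ (Fin 3))))
      [MeasureTheory.IsProbabilityMeasure μ]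
      (ℱ : ℕ → MeasurableSpace (Literature.MathematicalPhysics.QuantumLattice.FieldConfig (EuclideanSpace ℝ (Fin 3)))),
      Antitone ℱ →
      (∀ n, ℱ n ≤ Literature.MathematicalPhysics.QuantumLattice.FieldConfig.instMeasurableSpace) →
      ∀ (F G : Literature.MathematicalPhysics.QuantumLattice.FieldConfig (EuclideanSpace ℝ (Fin 3)) → ℝ) (C : ℝ),
        Measurable F → (∀ ω, |F ω| ≤ C) → Measurable[⨅ n, ℱ n] G → (∀ ω, |G ω| ≤ C) →
        (∀ᵐ ω ∂μ, Filter.Tendsto (fun n => MeasureTheory.condExp (ℱ n) μ F ω) Filter.atTop (nhds (G ω))) →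
        G =ᵐ[μ] MeasureTheory.condExp (⨅ n, ℱ n) μ F := by
  intro μ _ ℱ _ hle F G C hFm hFb hGm hGb hlim
  exact ae_eq_condExp_iInf_of_tendsto_condExp μ ℱ hle hFm hFb hGm hGb hlim

end Summit.CriticalPhenomena.Ising3DConformalLimit.Cruxes.GaussianLimitIsFree.Birth
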